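import Literature.MathematicalPhysics.QuantumFieldTheory.Balaban1983to89.B15Space164Descent
import Literature.MathematicalPhysics.QuantumFieldTheory.Balaban1983to89.B8Eq17ClassAkV1

/-!
# `Balaban1983to89.B15Space164DescentSets` — T. Bałaban, *Large field renormalization. I. The basic step of the 𝐑 operation*,
Commun. Math. Phys. **122** (1989) 175–202 [Balaban1989LargeFieldI], pp. 190–191: the region and cube families of (1.64)–(1.69) BUILT
FROM THE PRINTED SITE SETS `X`, `{Ω″_m}`, `{Ω_m}` and the cube partitions, and print's nesting sentences ⇒ the located bookkeeping
`B15Space164Descent.Nested` between two consecutive levels — so that «They form a descending sequence for increasing n» holds for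
the frames print describes, the remaining hypotheses being print's geometric sentences on site sets

HONEST FRAMING (cell `lit-balaban`, verbatim): statement-level skeleton of published theorems with citation tags; proofs where landed; nothing here is a claim about the Yang–Mills mass gap.

PDF held: `paper:balaban1989-cmp122-large-field-i` (journal page = PDF page + 174); pp. 179, 190–191 (renders `…-p005-x2.png`,
`…-p016-x2.png`, `…-p017-x2.png` of `b2b-balaban-ref1/pages/1989-cmp122-large-field-I/`).  Numbering note (referee N-g113-2 on
`B15RegularSpaces164`): the display called (1.64) here and there — point (i) — carries no printed label on p. 190; it is the first display
after the printed (1.63), and the labels (1.65), (1.66), (1.67) (p. 190), (1.68), (1.69) (p. 191) are printed (renders re-read).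

WHAT IS REPRODUCED.  Cells for SKELETON row `B15.Claim@191` (with `B15Space164Descent`, p29 gen 43, and `B15RegularSpaces164`, p29
gen 42; row `B15.Eq1.64–1.69` for the families).  `B15Space164Descent` proves the descent of the typed spaces under a Prop-structure
`Nested c R′ R` relating the level-`(n+1)` and level-`n` region / cube families AS INDEX SETS (regions are data, F5).  THIS file builds
those families from site sets exactly as print words them — «on (Ω″_m∖Ω″_{m+1})∩X for m = 1,…,j−1, and on (Ω″_j∖Ω_{k₀+1})∩X for m = j»,
«for □ ⊂ Ω″_m, □∩Ω″^c_{m+1} ≠ ∅ …, □ ⊂ Ω″_j, □∩Ω^c_{k₀+1} ≠ ∅ if m = j, □ is of the size CML^mη», «on (Ω_m∖Ω_{m+1})∩X for m =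
k₀+1,…,j», «for □ ⊂ Ω_m, □∩Ω^c_{m+1} ≠ ∅, □ is of the size CML^jη», «on (Ω_m∖Ω_{m+1})∩X for m = j+1,…,k−1, and on Ω_k∩X for m = k»,
«for □ ⊂ Ω_m, □∩Ω^c_{m+1} ≠ ∅ if m = j+1,…,k−1, and for □ ⊂ Ω_k if m = k, □ is of the size CML^mη» — with the [Balaban1985RegularSpaces]
p. 77 / [Balaban1987RG1] p. 251 convention for «on a region» (a plaquette / bond / derivative stencil belongs to a site set iff one of its
sites does: `B8Eq17ClassAkV1.plaqsOf`, `B15DeterminingSets.bondsOf`, `dpairsOf`), and PROVES `Nested` from print's sentences on the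
site sets: `{Ω_m}` decreasing ([Balaban1988Convergent] (2.1)), `Ω_{j+1} ⊂ Ω″_{j+1}` ((1.12): `Ω″_m = (Z″ᶜ_m∩Z)∪(Ω_m∩Zᶜ) ⊇ Ω_m`), the
cube partition of scale `j` refines that of scale `j+1`, and `Ω″_{j+1}` and the domains `Ω_m`, `m ≥ k₀+1`, are unions of cubes of scale
`j+1` (p. 179 «admissible sequence of domains based on partitions into M-cubes in the corresponding scales» and the definition of `k₀`:
`L^{−N₀+1}MR_{k₀+1} = M`, i.e. the domains above `k₀` are built from cubes of the unit scale).

THE TYPING.  `Geom P l` = the site-set data of one lattice: `X`, `m ↦ Ω″_m`, `m ↦ Ω_m`, and `s ↦` the partition into cubes «of the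
size CML^sη» (`Q s : Set (Set (Site P l))`); `regionOf Y` = the index sets of a site set `Y` under the p. 77 convention; `setI/setII/setIII`
= the printed layer sets of (i)/(ii)/(iii) at the constants `c` (level `n`, `j = c.j`); `famI/famII/famIII` = the printed cube families
(regions `□∩X`); **`layersOfGeom c S G Gp : Layers S`** = the level-`n` families of `B15Space164Descent` from the η-lattice data `G` and the
data `Gp p` of the lattices of `U_{p,X}`; `RegionHyp`/`CubeHyp` = print's sentences as hypotheses.  PROVED: `regionOf_mono`,
`regionOf_union` (the convention distributes over unions — the reason the covering of `Nested` is exact); the set algebra of the rung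
`j` («(Ω″_j∖Ω_{k₀+1}) = (Ω″_j∖Ω″_{j+1}) ∪ (Ω″_{j+1}∖Ω_{k₀+1})»); the parent cube lemma `parent_subset_of_union` (a cube of scale `j` inside a
union of cubes of scale `j+1` has its parent there); **`nested_layersOfGeom`**: `Nested c (layersOfGeom (succC c) S G Gp) (layersOfGeom c
S G Gp)`; **`space164_descent_geom`**: the descent `Ũ^{(n+1)c}_k ⊆ Ũ^{(n)c}_k` for the frames built from print's site sets, under print's
«β ≤ 1/4 and L₀² ≤ (1/3)L», `1 ≤ L₀`, growth ratio `≤ 9/4`, and the geometric sentences.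
HONEST SCOPE.  (1) The site sets, partitions and the functions `U_{p,X}`, `J_{p,X}` stay data; the (2.13)-admissibility of `{Ω″_m}`,
`{Ω_m}` is used only through the located sentences of `RegionHyp`/`CubeHyp` (nesting; unions of cubes of the next scale — for cubes
«of the size CML^{j+1}η» this asks `C = 1` or `C ∣` the block numbers, print: «we can assume that C ≦ 2»; recorded, not resolved).
(2) `T = id` as in `B15Space164Descent`.  (3) The convention for «on a region» is the p. 77 one of the tree; with the «all corners inside»
convention the covering of rung `j` would lose the stencils straddling `∂Ω″_{j+1}` (recorded).  No `Prop` placeholder, no new fact; axioms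
standard.  Unit `lit-balaban-p29` (Phase-2 seat p29 gen 43; TAKING #2 line HOME/STATUS.md), HOME `run/shared/lean/pub/lit-balaban/`.
-/

namespace Literature.MathematicalPhysics.QuantumFieldTheory.Balaban1983to89.B15Space164DescentSets

open Literature.MathematicalPhysics.QuantumFieldTheory.Balaban1983to89
open Literature.MathematicalPhysics.QuantumFieldTheory.Balaban1983to89.B12RegularSpaces111
open Literature.MathematicalPhysics.QuantumFieldTheory.Balaban1983to89.B14RegularSpaces234
open Literature.MathematicalPhysics.QuantumFieldTheory.Balaban1983to89.B15.ComplexSpaces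
open Literature.MathematicalPhysics.QuantumFieldTheory.Balaban1983to89.B15RegularSpaces164
open Literature.MathematicalPhysics.QuantumFieldTheory.Balaban1983to89.B15Space164Descent
open Literature.MathematicalPhysics.QuantumFieldTheory.Balaban1983to89.B8Eq17ClassAkV1 (plaqsOf plaqsOf_mono)
open Literature.MathematicalPhysics.QuantumFieldTheory.Balaban1983to89.B15DeterminingSets (bondsOf)

noncomputable section

/-! ## §1. «on a region»: index sets of a site set (p. 77 convention), monotone and distributing over unions -/

section RegionOf

variable {P : Params} {l : ℕ}

/-- The derivative stencils `(x, μ, ν)` — `(∇_μ A_ν)(x)` reads `A` at `⟨x, ν⟩`, `⟨x+e_μ, ν⟩` — «on» a site set `Y`: one of the four sites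
`x, x+e_μ, x+e_ν, x+e_μ+e_ν` lies in `Y` (the p. 77 convention of [Balaban1985RegularSpaces], as `plaqsOf` / `bondsOf`).
[cite: Balaban1989LargeFieldI, (1.64) p.190] -/
def dpairsOf (Y : Set (Site P l)) : Set (Site P l × Fin P.d × Fin P.d) :=
  {q | q.1 ∈ Y ∨ q.1.shift q.2.1 ∈ Y ∨ q.1.shift q.2.2 ∈ Y ∨ (q.1.shift q.2.1).shift q.2.2 ∈ Y}

/-- The region-as-index-sets of a site set `Y`: plaquettes, bonds and derivative stencils «on Y» (p. 77 convention).
[cite: Balaban1989LargeFieldI, (1.64) p.190] -/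
def regionOf (Y : Set (Site P l)) : Region P l where
  plaqs := plaqsOf Y
  bonds := bondsOf Y
  dpairs := dpairsOf Y

/-- `bondsOf` is monotone. [cite: Balaban1989LargeFieldI, (1.64) p.190] -/
theorem bondsOf_mono {Y Y' : Set (Site P l)} (h : Y ⊆ Y') : bondsOf Y ⊆ bondsOf Y' := fun _ hb =>
  hb.elim (fun h1 => Or.inl (h h1)) (fun h2 => Or.inr (h h2))

/-- `dpairsOf` is monotone. [cite: Balaban1989LargeFieldI, (1.64) p.190] -/
theorem dpairsOf_mono {Y Y' : Set (Site P l)} (h : Y ⊆ Y') : dpairsOf Y ⊆ dpairsOf Y' := by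
  intro q hq
  rcases hq with h1 | h2 | h3 | h4
  exacts [Or.inl (h h1), Or.inr (Or.inl (h h2)), Or.inr (Or.inr (Or.inl (h h3))), Or.inr (Or.inr (Or.inr (h h4)))]

/-- `regionOf` is monotone: `Y ⊆ Y′ ⇒ regionOf Y ⊆ regionOf Y′` as index sets. [cite: Balaban1989LargeFieldI, (1.64) p.190] -/
theorem regionOf_mono {Y Y' : Set (Site P l)} (h : Y ⊆ Y') : RSub (regionOf Y) (regionOf Y') :=
  ⟨plaqsOf_mono h, bondsOf_mono h, dpairsOf_mono h⟩

/-- **The convention distributes over unions**: a stencil with a site in `Y₁ ∪ Y₂` has a site in `Y₁` or in `Y₂`, so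
`regionOf (Y₁ ∪ Y₂)` is covered by `regionOf Y₁`, `regionOf Y₂` (exactly; no straddling loss). [cite: Balaban1989LargeFieldI, (1.64) p.190] -/
theorem regionOf_union (Y₁ Y₂ : Set (Site P l)) : RCovers (regionOf (Y₁ ∪ Y₂)) (regionOf Y₁) (regionOf Y₂) := by
  refine ⟨fun p hp => ?_, fun b hb => ?_, fun q hq => ?_⟩
  · rcases hp with h | h | h | h
    · exact h.elim (fun h => Or.inl (Or.inl h)) (fun h => Or.inr (Or.inl h))
    · exact h.elim (fun h => Or.inl (Or.inr (Or.inl h))) (fun h => Or.inr (Or.inr (Or.inl h)))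
    · exact h.elim (fun h => Or.inl (Or.inr (Or.inr (Or.inl h)))) (fun h => Or.inr (Or.inr (Or.inr (Or.inl h))))
    · exact h.elim (fun h => Or.inl (Or.inr (Or.inr (Or.inr h)))) (fun h => Or.inr (Or.inr (Or.inr (Or.inr h))))
  · rcases hb with h | h
    · exact h.elim (fun h => Or.inl (Or.inl h)) (fun h => Or.inr (Or.inl h))
    · exact h.elim (fun h => Or.inl (Or.inr h)) (fun h => Or.inr (Or.inr h))
  · rcases hq with h | h | h | h
    · exact h.elim (fun h => Or.inl (Or.inl h)) (fun h => Or.inr (Or.inl h))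
    · exact h.elim (fun h => Or.inl (Or.inr (Or.inl h))) (fun h => Or.inr (Or.inr (Or.inl h)))
    · exact h.elim (fun h => Or.inl (Or.inr (Or.inr (Or.inl h)))) (fun h => Or.inr (Or.inr (Or.inr (Or.inl h))))
    · exact h.elim (fun h => Or.inl (Or.inr (Or.inr (Or.inr h)))) (fun h => Or.inr (Or.inr (Or.inr (Or.inr h))))

/-- Covering from a set inclusion into a union. [cite: Balaban1989LargeFieldI, (1.64) p.190] -/
theorem regionOf_covers {Y Y₁ Y₂ : Set (Site P l)} (h : Y ⊆ Y₁ ∪ Y₂) : RCovers (regionOf Y) (regionOf Y₁) (regionOf Y₂) := by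
  have hm := regionOf_mono h
  have hu := regionOf_union Y₁ Y₂
  exact ⟨fun p hp => hu.1 (hm.1 hp), fun b hb => hu.2.1 (hm.2.1 hb), fun q hq => hu.2.2 (hm.2.2 hq)⟩

end RegionOf

/-! ## §2. The printed site sets and cube partitions of one lattice; the layer sets and cube families of (i)/(ii)/(iii) -/

section GeomDef

variable {P : Params} {l : ℕ}

/-- The site-set data of (1.64)–(1.69) in one lattice: the localization domain `X`, the sequences `{Ω″_m}` ((1.12)) and `{Ω_m}`, and for each
scale `s` the partition of the lattice into the cubes «of the size CML^sη». Data. [cite: Balaban1989LargeFieldI, (1.64)-(1.69) pp.190–191] -/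
structure Geom (P : Params) (l : ℕ) where
  /-- `X` -/
  X : Set (Site P l)
  /-- `m ↦ Ω″_m` -/
  ΩPP : ℕ → Set (Site P l)
  /-- `m ↦ Ω_m` -/
  Ω : ℕ → Set (Site P l)
  /-- `s ↦` the cubes «of the size CML^sη» partitioning the lattice -/
  Q : ℕ → Set (Set (Site P l))

/-- (i) at level `n` (`j = c.j`): the layer set «(Ω″_m∖Ω″_{m+1})∩X for m = 1,…,j−1, and (Ω″_j∖Ω_{k₀+1})∩X for m = j» (the printed range
`m ≤ j` is imposed by `CondI164`; for `m > j` the value is irrelevant). [cite: Balaban1989LargeFieldI, (1.64) p.190] -/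
def setI (c : CConsts) (G : Geom P l) (m : ℕ) : Set (Site P l) :=
  (G.ΩPP m \ (if m < c.j then G.ΩPP (m + 1) else G.Ω (c.k₀ + 1))) ∩ G.X

/-- (1.65) at level `n`: the cube regions `□∩X` for «□ ⊂ Ω″_m, □∩Ω″^c_{m+1} ≠ ∅ if m = 1,…,j−1, and for □ ⊂ Ω″_j, □∩Ω^c_{k₀+1} ≠ ∅ if
m = j, □ is of the size CML^mη». [cite: Balaban1989LargeFieldI, (1.65) p.190] -/
def famI (c : CConsts) (G : Geom P l) (m : ℕ) : Set (Region P l) :=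
  {D | ∃ B ∈ G.Q m, B ⊆ G.ΩPP m ∧ (B \ (if m < c.j then G.ΩPP (m + 1) else G.Ω (c.k₀ + 1))).Nonempty ∧ D = regionOf (B ∩ G.X)}

/-- (ii): the shell set «(Ω_m∖Ω_{m+1})∩X» (`m = k₀+1, …, j`). [cite: Balaban1989LargeFieldI, (1.66) p.190] -/
def setII (G : Geom P l) (m : ℕ) : Set (Site P l) :=
  (G.Ω m \ G.Ω (m + 1)) ∩ G.X

/-- (1.67) at level `n`: the cube regions `□∩X` for «□ ⊂ Ω_m, □∩Ω^c_{m+1} ≠ ∅, □ is of the size CML^jη» — cubes of the scale `j` of the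
LEVEL in every shell. [cite: Balaban1989LargeFieldI, (1.67) p.190] -/
def famII (c : CConsts) (G : Geom P l) (m : ℕ) : Set (Region P l) :=
  {D | ∃ B ∈ G.Q c.j, B ⊆ G.Ω m ∧ (B \ G.Ω (m + 1)).Nonempty ∧ D = regionOf (B ∩ G.X)}

/-- (iii): the layer set «(Ω_m∖Ω_{m+1})∩X for m = j+1,…,k−1, and Ω_k∩X for m = k». [cite: Balaban1989LargeFieldI, (1.68) p.191] -/
def setIII (c : CConsts) (G : Geom P l) (m : ℕ) : Set (Site P l) :=
  (G.Ω m \ (if m < c.k then G.Ω (m + 1) else ∅)) ∩ G.X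

/-- (1.69): the cube regions `□∩X` for «□ ⊂ Ω_m, □∩Ω^c_{m+1} ≠ ∅ if m = j+1,…,k−1, and for □ ⊂ Ω_k if m = k, □ is of the size CML^mη».
[cite: Balaban1989LargeFieldI, (1.69) p.191] -/
def famIII (c : CConsts) (G : Geom P l) (m : ℕ) : Set (Region P l) :=
  {D | ∃ B ∈ G.Q m, B ⊆ G.Ω m ∧ (m < c.k → (B \ G.Ω (m + 1)).Nonempty) ∧ D = regionOf (B ∩ G.X)}

end GeomDef

section LayersDef

variable {P : Params} {i : ℕ} {𝔸 : Type*} [Monoid 𝔸]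

/-- **The level-`n` families of `B15Space164Descent` from print's site sets**: layers and cubes of (i)/(ii)/(iii) in the `η`-lattice
from `G`, and the layers in the lattices of `U_{p,X}` from `Gp p`. [cite: Balaban1989LargeFieldI, (1.64)-(1.69) pp.190–191] -/
def layersOfGeom (c : CConsts) (S : Shared P i 𝔸) (G : Geom P i) (Gp : (p : ℕ) → Geom P (S.lvl p)) : Layers S where
  layerI m := regionOf (setI c G m)
  cubesI := famI c G
  layerII m := regionOf (setII G m)
  cubesII := famII c G
  layerIII m := regionOf (setIII c G m)
  cubesIII := famIII c G
  player p m := regionOf (setI c (Gp p) m)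
  playerII p m := regionOf (setII (Gp p) m)
  playerIII p m := regionOf (setIII c (Gp p) m)

end LayersDef

/-! ## §3. Print's geometric sentences as hypotheses on the site sets -/

section Hyps

variable {P : Params} {l : ℕ}

/-- The sentences on the SEQUENCES used by the descent at level `n` (`j = c.j`): `{Ω_m}` is decreasing ([III] (2.1) «Ω₀ ⊃ Ω₁ ⊃ ⋯»),
`Ω_{j+1} ⊂ Ω″_{j+1}` ((1.12)), the sequence `{Ω_m}` ends at `k` (`Ω_{k+1} = ∅`, the convention making «□∩Ω^c_{k+1} ≠ ∅» vacuous), and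
`k₀ < k` (`N₀ ≥ 1`, p. 179 «the smallest positive integer N₀»). [cite: Balaban1989LargeFieldI, (1.12) p.179] -/
structure RegionHyp (c : CConsts) (G : Geom P l) : Prop where
  /-- `{Ω_m}` decreasing -/
  anti : ∀ m m', m ≤ m' → G.Ω m' ⊆ G.Ω m
  /-- `Ω_{j+1} ⊆ Ω″_{j+1}` -/
  sub : G.Ω (c.j + 1) ⊆ G.ΩPP (c.j + 1)
  /-- `Ω_{k+1} = ∅` -/
  top : G.Ω (c.k + 1) = ∅
  /-- `k₀ + 1 ≤ k` -/
  k₀_lt : c.k₀ + 1 ≤ c.k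

/-- The sentences on the CUBES used by the descent at level `n`: the cubes are nonempty, every cube of scale `j` lies in a cube of scale
`j+1` (the partitions refine), the cubes of scale `j+1` are pairwise disjoint, and `Ω″_{j+1}` as well as the domains `Ω_m`, `m ≥ k₀+1`,
are unions of cubes of scale `j+1` (p. 179 «admissible sequence of domains based on partitions into M-cubes in the corresponding scales»,
and the domains above `k₀` are built from cubes of the unit scale by the definition of `k₀`). [cite: Balaban1989LargeFieldI, p.179] -/
structure CubeHyp (c : CConsts) (G : Geom P l) : Prop where
  /-- cubes are nonempty -/
  nonempty : ∀ s, ∀ B ∈ G.Q s, B.Nonempty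
  /-- scale `j` refines scale `j+1` -/
  tower : ∀ B ∈ G.Q c.j, ∃ B' ∈ G.Q (c.j + 1), B ⊆ B'
  /-- cubes of scale `j+1` are pairwise disjoint -/
  disj : ∀ B₁ ∈ G.Q (c.j + 1), ∀ B₂ ∈ G.Q (c.j + 1), (B₁ ∩ B₂).Nonempty → B₁ = B₂
  /-- `Ω″_{j+1}` is a union of cubes of scale `j+1` -/
  unionPP : ∃ F ⊆ G.Q (c.j + 1), G.ΩPP (c.j + 1) = ⋃₀ F
  /-- `Ω_m`, `k₀+1 ≤ m ≤ j`, is a union of cubes of scale `j+1` -/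
  unionΩ : ∀ m, c.k₀ + 1 ≤ m → m ≤ c.j → ∃ F ⊆ G.Q (c.j + 1), G.Ω m = ⋃₀ F

/-- **Parent cubes**: if `B ⊆ B′`, `B` nonempty, `B′` a cube of a pairwise disjoint family `Q′`, and `B ⊆ ⋃₀ F` for a subfamily
`F ⊆ Q′`, then `B′ ∈ F`, hence `B′ ⊆ ⋃₀ F`. [cite: Balaban1989LargeFieldI, p.179] -/
theorem parent_subset_of_union {α : Type*} {Q' F : Set (Set α)} {B B' : Set α} (hdisj : ∀ B₁ ∈ Q', ∀ B₂ ∈ Q', (B₁ ∩ B₂).Nonempty → B₁ = B₂)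
    (hF : F ⊆ Q') (hB' : B' ∈ Q') (hBB' : B ⊆ B') (hne : B.Nonempty) (hBU : B ⊆ ⋃₀ F) : B' ⊆ ⋃₀ F := by
  obtain ⟨x, hx⟩ := hne
  obtain ⟨B₂, hB₂F, hxB₂⟩ := Set.mem_sUnion.mp (hBU hx)
  have heq : B' = B₂ := hdisj B' hB' B₂ (hF hB₂F) ⟨x, hBB' hx, hxB₂⟩
  rw [heq]
  exact Set.subset_sUnion_of_mem hB₂F

end Hyps

/-! ## §4. Print's sentences ⇒ the located bookkeeping `Nested` -/

section NestedProof

variable {P : Params} {l : ℕ}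

/-- Rung `m < j` of (i): the same set at both levels. [cite: Balaban1989LargeFieldI, (1.64) p.190] -/
theorem setI_of_lt (c : CConsts) (G : Geom P l) {m : ℕ} (hm : m < c.j) :
    setI c G m = (G.ΩPP m \ G.ΩPP (m + 1)) ∩ G.X := by
  unfold setI; rw [if_pos hm]

/-- Rung `m < j+1` of (i) at level `n+1`. [cite: Balaban1989LargeFieldI, (1.64) p.190] -/
theorem setI_succ_of_lt (c : CConsts) (G : Geom P l) {m : ℕ} (hm : m < c.j + 1) :
    setI (succC c) G m = (G.ΩPP m \ G.ΩPP (m + 1)) ∩ G.X := by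
  unfold setI; rw [succC_j, if_pos hm]

/-- Top rung `m = j` of (i): «(Ω″_j∖Ω_{k₀+1})∩X». [cite: Balaban1989LargeFieldI, (1.64) p.190] -/
theorem setI_self (c : CConsts) (G : Geom P l) : setI c G c.j = (G.ΩPP c.j \ G.Ω (c.k₀ + 1)) ∩ G.X := by
  unfold setI; rw [if_neg (lt_irrefl _)]

/-- Top rung `m = j+1` of (i) at level `n+1`. [cite: Balaban1989LargeFieldI, (1.64) p.190] -/
theorem setI_succ_self (c : CConsts) (G : Geom P l) : setI (succC c) G (c.j + 1) = (G.ΩPP (c.j + 1) \ G.Ω (c.k₀ + 1)) ∩ G.X := by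
  unfold setI; rw [succC_j, if_neg (lt_irrefl _)]; rfl

/-- **The set algebra of the top rung**: `(Ω″_j∖Ω_{k₀+1})∩X ⊆ (Ω″_j∖Ω″_{j+1})∩X ∪ (Ω″_{j+1}∖Ω_{k₀+1})∩X` (no nesting needed).
[cite: Balaban1989LargeFieldI, (1.64) p.190] -/
theorem setI_self_subset (c : CConsts) (G : Geom P l) :
    setI c G c.j ⊆ setI (succC c) G c.j ∪ setI (succC c) G (c.j + 1) := by
  rw [setI_self, setI_succ_of_lt c G (Nat.lt_succ_self _), setI_succ_self]
  rintro x ⟨⟨hx, hx'⟩, hX⟩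
  by_cases h : x ∈ G.ΩPP (c.j + 1)
  · exact Or.inr ⟨⟨h, hx'⟩, hX⟩
  · exact Or.inl ⟨⟨hx, h⟩, hX⟩

/-- (iii) below the top scale: «(Ω_m∖Ω_{m+1})∩X». [cite: Balaban1989LargeFieldI, (1.68) p.191] -/
theorem setIII_of_lt (c : CConsts) (G : Geom P l) {m : ℕ} (hm : m < c.k) : setIII c G m = (G.Ω m \ G.Ω (m + 1)) ∩ G.X := by
  unfold setIII; rw [if_pos hm]

/-- (iii) at the top scale: «Ω_k∩X». [cite: Balaban1989LargeFieldI, (1.68) p.191] -/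
theorem setIII_top (c : CConsts) (G : Geom P l) : setIII c G c.k = G.Ω c.k ∩ G.X := by
  unfold setIII; rw [if_neg (lt_irrefl _), Set.sdiff_empty]

/-- The rung `j+1` of (iii) at level `n` IS the shell `j+1` of (ii) (with `Ω_{k+1} = ∅` at the top scale).
[cite: Balaban1989LargeFieldI, (1.68) p.191] -/
theorem setIII_eq_setII {c : CConsts} {G : Geom P l} (htop : G.Ω (c.k + 1) = ∅) {m : ℕ} (hm : m ≤ c.k) :
    setIII c G m = setII G m := by
  rcases hm.lt_or_eq with h | h
  · rw [setIII_of_lt c G h]; rfl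
  · subst h; rw [setIII_top]; unfold setII; rw [htop, Set.sdiff_empty]

/-- The rung `j+1` of (iii) at level `n` lies in the rung `j+1` of (i) at level `n+1` when `j+1 ≤ k₀`:
«(Ω_{j+1}∖Ω_{j+2}) ⊆ (Ω″_{j+1}∖Ω_{k₀+1})» from `Ω_{j+1} ⊆ Ω″_{j+1}` and `Ω_{k₀+1} ⊆ Ω_{j+2}`. [cite: Balaban1989LargeFieldI, p.191] -/
theorem setIII_subset_setI {c : CConsts} {G : Geom P l} (hR : RegionHyp c G) (hk : c.j + 1 ≤ c.k₀) :
    setIII c G (c.j + 1) ⊆ setI (succC c) G (c.j + 1) := by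
  have hlt : c.j + 1 < c.k := lt_of_le_of_lt hk (by have := hR.k₀_lt; omega)
  rw [setIII_of_lt c G hlt, setI_succ_self]
  rintro x ⟨⟨hx, hx'⟩, hX⟩
  exact ⟨⟨hR.sub hx, fun h => hx' (hR.anti (c.j + 1 + 1) (c.k₀ + 1) (by omega) h)⟩, hX⟩

variable {i : ℕ} {𝔸 : Type*} [Monoid 𝔸]

/-- **Print's sentences ⇒ `Nested`**: for the families built from the site sets, the located bookkeeping of `B15Space164Descent` between
level `n+1` and level `n` holds as soon as the region sentences hold in every lattice and the cube sentences hold in the `η`-lattice.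
[cite: Balaban1989LargeFieldI, (1.64)-(1.69) pp.190–191] -/
theorem nested_layersOfGeom (c : CConsts) (S : Shared P i 𝔸) {G : Geom P i} {Gp : (p : ℕ) → Geom P (S.lvl p)}
    (hjk : c.j + 1 ≤ c.k) (hR : RegionHyp c G) (hC : CubeHyp c G) (hRp : ∀ p, RegionHyp c (Gp p)) :
    Nested c (layersOfGeom (succC c) S G Gp) (layersOfGeom c S G Gp) where
  subI m _ hm := by
    show RSub (regionOf (setI c G m)) (regionOf (setI (succC c) G m))
    rw [setI_of_lt c G hm, setI_succ_of_lt c G (Nat.lt_succ_of_lt hm)]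
    exact rsub_refl _
  subIp m _ hm p := by
    show RSub (regionOf (setI c (Gp p) m)) (regionOf (setI (succC c) (Gp p) m))
    rw [setI_of_lt c (Gp p) hm, setI_succ_of_lt c (Gp p) (Nat.lt_succ_of_lt hm)]
    exact rsub_refl _
  cubesI m _ hm := by
    show famI c G m ⊆ famI (succC c) G m
    rintro D ⟨B, hB, hBΩ, hne, rfl⟩
    refine ⟨B, hB, hBΩ, ?_, rfl⟩
    rw [succC_j, if_pos (Nat.lt_succ_of_lt hm)]
    rwa [if_pos hm] at hne
  topI := by
    show RCovers (regionOf (setI c G c.j)) (regionOf (setI (succC c) G c.j)) (regionOf (setI (succC c) G (c.j + 1)))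
    exact regionOf_covers (setI_self_subset c G)
  topIp p := by
    show RCovers (regionOf (setI c (Gp p) c.j)) (regionOf (setI (succC c) (Gp p) c.j))
      (regionOf (setI (succC c) (Gp p) (c.j + 1)))
    exact regionOf_covers (setI_self_subset c (Gp p))
  cubesTopI D hD := by
    change D ∈ famI c G c.j at hD
    show D ∈ famI (succC c) G c.j ∨ ∃ D' ∈ famI (succC c) G (c.j + 1), RSub D D'
    obtain ⟨B, hB, hBΩ, hne, rfl⟩ := hD
    rw [if_neg (lt_irrefl _)] at hne
    by_cases hcase : (B \ G.ΩPP (c.j + 1)).Nonempty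
    · -- «□∩Ω″^c_{j+1} ≠ ∅»: a rung-`j` cube of level `n+1`
      refine Or.inl ⟨B, hB, hBΩ, ?_, rfl⟩
      rw [succC_j, if_pos (Nat.lt_succ_self _)]
      exact hcase
    · -- `□ ⊂ Ω″_{j+1}`: its parent of scale `j+1` lies in `Ω″_{j+1}` and meets `Ω^c_{k₀+1}`
      have hsub : B ⊆ G.ΩPP (c.j + 1) := fun x hx => by
        by_contra hx'; exact hcase ⟨x, hx, hx'⟩
      obtain ⟨B', hB', hBB'⟩ := hC.tower B hB
      obtain ⟨F, hF, hU⟩ := hC.unionPP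
      have hBne : B.Nonempty := hne.mono Set.sdiff_subset
      have hB'Ω : B' ⊆ G.ΩPP (c.j + 1) := by
        rw [hU]; exact parent_subset_of_union hC.disj hF hB' hBB' hBne (hU ▸ hsub)
      refine Or.inr ⟨regionOf (B' ∩ G.X), ⟨B', hB', hB'Ω, ?_, rfl⟩, regionOf_mono (Set.inter_subset_inter_left _ hBB')⟩
      rw [succC_j, if_neg (lt_irrefl _)]
      exact hne.mono (Set.sdiff_subset_sdiff_left hBB')
  subII m _ _ := rsub_refl _
  subIIp m _ _ p := rsub_refl _
  cubesII m hm hmj D hD := by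
    change D ∈ famII c G m at hD
    show ∃ D' ∈ famII (succC c) G m, RSub D D'
    obtain ⟨B, hB, hBΩ, hne, rfl⟩ := hD
    obtain ⟨B', hB', hBB'⟩ := hC.tower B hB
    obtain ⟨F, hF, hU⟩ := hC.unionΩ m hm hmj
    have hBne : B.Nonempty := hne.mono Set.sdiff_subset
    have hB'Ω : B' ⊆ G.Ω m := by
      rw [hU]; exact parent_subset_of_union hC.disj hF hB' hBB' hBne (hU ▸ hBΩ)
    refine ⟨regionOf (B' ∩ G.X), ⟨B', ?_, hB'Ω, hne.mono (Set.sdiff_subset_sdiff_left hBB'), rfl⟩,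
      regionOf_mono (Set.inter_subset_inter_left _ hBB')⟩
    rw [succC_j]; exact hB'
  subIII m hm hmk := by
    show RSub (regionOf (setIII c G m)) (regionOf (setIII (succC c) G m))
    exact rsub_refl _
  subIIIp m hm hmk p := by
    show RSub (regionOf (setIII c (Gp p) m)) (regionOf (setIII (succC c) (Gp p) m))
    exact rsub_refl _
  cubesIII m hm hmk := by
    show famIII c G m ⊆ famIII (succC c) G m
    exact subset_rfl
  upII hk := by
    show RSub (regionOf (setIII c G (c.j + 1))) (regionOf (setII G (c.j + 1)))
    rw [setIII_eq_setII hR.top hjk]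
    exact rsub_refl _
  upIIp hk p := by
    show RSub (regionOf (setIII c (Gp p) (c.j + 1))) (regionOf (setII (Gp p) (c.j + 1)))
    rw [setIII_eq_setII (hRp p).top hjk]
    exact rsub_refl _
  cubesUpII hk := by
    show famIII c G (c.j + 1) ⊆ famII (succC c) G (c.j + 1)
    rintro D ⟨B, hB, hBΩ, hne, rfl⟩
    refine ⟨B, by rw [succC_j]; exact hB, hBΩ, ?_, rfl⟩
    rcases Nat.lt_or_ge (c.j + 1) c.k with hlt | hge
    · exact hne hlt
    · have hk' : c.j + 1 = c.k := le_antisymm hjk hge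
      rw [hk', hR.top, Set.sdiff_empty]
      exact hC.nonempty _ B (hk' ▸ hB)
  upI hk := by
    show RSub (regionOf (setIII c G (c.j + 1))) (regionOf (setI (succC c) G (c.j + 1)))
    exact regionOf_mono (setIII_subset_setI hR hk)
  upIp hk p := by
    show RSub (regionOf (setIII c (Gp p) (c.j + 1))) (regionOf (setI (succC c) (Gp p) (c.j + 1)))
    exact regionOf_mono (setIII_subset_setI (hRp p) hk)
  cubesUpI hk := by
    show famIII c G (c.j + 1) ⊆ famI (succC c) G (c.j + 1)
    have hlt : c.j + 1 < c.k := by have := hR.k₀_lt; omega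
    rintro D ⟨B, hB, hBΩ, hne, rfl⟩
    refine ⟨B, hB, hBΩ.trans hR.sub, ?_, rfl⟩
    rw [succC_j, if_neg (lt_irrefl _)]
    exact (hne hlt).mono (Set.sdiff_subset_sdiff_right (hR.anti (c.j + 1 + 1) (c.k₀ + 1) (by omega)))

end NestedProof

/-! ## §5. The descent for the frames built from print's site sets -/

section DescentGeom

variable {P : Params} {i : ℕ} {𝔸 : Type*} [NormedRing 𝔸] [NormedAlgebra ℂ 𝔸] [CompleteSpace 𝔸]
variable (𝓜 : CModel 𝔸) {S : Shared P i 𝔸} {c : CConsts} {α₀ α₁ : ℕ → ℝ}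

/-- **«They form a descending sequence for increasing n» for the frames print describes**: with the level families built from the site
sets `X`, `{Ω″_m}`, `{Ω_m}` and the cube partitions (`layersOfGeom`), `Ũ^{(n+1)c}_k(X, α̃₀, α̃₁) ⊆ Ũ^{(n)c}_k(X, α̃₀, α̃₁)` under print's
«β ≤ 1/4 and L₀² ≤ (1/3)L» (`1 ≤ L₀`, growth ratio of the sequences `≤ 9/4` at `j`, `η > 0`, `BCM ≥ 0`, `h ≤ j < k`) and print's
geometric sentences `RegionHyp` (every lattice) / `CubeHyp` (the `η`-lattice). [cite: Balaban1989LargeFieldI, p.191] -/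
theorem space164_descent_geom {G : Geom P i} {Gp : (p : ℕ) → Geom P (S.lvl p)} (hR : RegionHyp c G) (hC : CubeHyp c G)
    (hRp : ∀ p, RegionHyp c (Gp p)) (hhj : c.h ≤ c.j) (hjk : c.j + 1 ≤ c.k) (hβ : 0 ≤ c.β) (hβ4 : c.β ≤ 1 / 4)
    (hL₀ : 1 ≤ c.L₀) (hthird : c.L₀ ^ 2 ≤ c.L / 3) (hη : 0 < c.η) (hBCM : 0 ≤ c.B * c.C * c.M) (hα₀ : ∀ m, 0 ≤ α₀ m)
    (hα₁ : ∀ m, 0 ≤ α₁ m) {ρ : ℝ} (hρ : 0 ≤ ρ) (hρ94 : ρ ≤ 9 / 4) (h0g : α₀ (c.j + 1) ≤ ρ * α₀ c.j)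
    (h1g : α₁ (c.j + 1) ≤ ρ * α₁ c.j) :
    space164 𝓜 (frameOf S (layersOfGeom (succC c) S G Gp)) (succC c) α₀ α₁ ⊆
      space164 𝓜 (frameOf S (layersOfGeom c S G Gp)) c α₀ α₁ :=
  space164_descent_printed 𝓜 (nested_layersOfGeom c S hjk hR hC hRp) hhj hjk hβ hβ4 hL₀ hthird hη hBCM hα₀ hα₁ hρ hρ94 h0g h1g

end DescentGeom

end

end Literature.MathematicalPhysics.QuantumFieldTheory.Balaban1983to89.B15Space164DescentSets
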